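import Summits.ValiantsHypothesis.ValiantsHypothesis.Theorems.LacunarySymmetroidMatrixDescartesChainLadder

/-!
# `MatrixDescartes` census — THE JUNCTION LAW FOR MATCHING JUNCTION INERTIA (Sylvester matching)

HONEST FRAMING.  Object-search cell `pub-symmetroid`, crux `Theses.LacunarySymmetroid.MatrixDescartes`
(stmt-ValiantsHypothesis-18050); seat val-sym-mdr-p1 (g8).  LOWER-bound / construction mathematics in census (CONJECTURE-A)
currency; it proves NOTHING about the crux `MatrixDescartes` (an UPPER-bound statement at fat formats), nothing about
`DoorA26` / `DoorA34`, nothing about `VP ≠ VNP`.  No definitions.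

The desk's general form of the chain lemma (R1909 (3)): «`ζ_sym(m, K₁+K₂−1) ≥ ζ₁ + ζ₂` for MATCHING JUNCTION INERTIA».  The junction law
(`Chain.exists_alternating_junction`) needs the bottom letter of the second certificate to EQUAL the top letter of the first; certificates are
invariant under congruence (`Chain.alternating_congr`) and under scaling by a nonzero constant (`alternating_smul`, this file), so it suffices
that the two junction letters be congruent up to sign.  For letters given IN SYLVESTER FORM — `Cᵀ A C = diagonal p`, `C'ᵀ B C' = diagonal q`
with invertible `C, C'` (for the cell's explicit rational letters such data come from a rational `L D Lᵀ` factorisation, checked by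
`norm_num`) — and a permutation `π` with `p i · q (π i) > 0` for all `i` (equal numbers of positive and of negative diagonal entries),
`exists_congr_of_diagonal` produces an invertible `E` with `Eᵀ B E = A` (`E = C'_π · diagonal √(p/q∘π) · C⁻¹`), and
`exists_alternating_junction_inertia` chains the two certificates, moving only the SECOND one (the first block stays verbatim) and
recording the Sylvester form of the new top letter (congruent to the second block's top letter), so that blocks can be appended one after
the other (`…ChainBlocks*.lean`: mixed chains of the cell's record certificates).  [folklore] (Sylvester's law of inertia in the
constructive direction actually used: matching signed diagonal forms are congruent).
-/

-- `Summit.ValiantsHypothesis.ValiantsHypothesis.…` repeats a component by the D-0017 layout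
-- (single-conjunct summit), which the `dupNamespace` linter flags; the name is mandated.
set_option linter.dupNamespace false

namespace Summit.ValiantsHypothesis.ValiantsHypothesis.Theorems.LacunarySymmetroidMatrixDescartes.Census.Chain

open Matrix Finset Filter Topology
open scoped BigOperators
open Summit.ValiantsHypothesis.ValiantsHypothesis.Theorems.LacunarySymmetroidMatrixDescartes.Census.Graft
open Summit.ValiantsHypothesis.ValiantsHypothesis.Theorems.MatrixDescartes.Negative (PosRootLawAt)

/-! ### Scaling invariance -/

/-- **Certificates are invariant under scaling** `S l ↦ c • S l`, `c ≠ 0`: every evaluated determinant is multiplied by `c^m`, so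
nonvanishing and alternation persist (and symmetry is kept).  With `c = −1` and `m` odd all signs flip. [folklore] -/
theorem alternating_smul {m K N : ℕ} (d : Fin K → ℕ) (S : Fin K → Matrix (Fin m) (Fin m) ℝ) (hS : ∀ l, (S l).IsSymm)
    (c : ℝ) (hc : c ≠ 0) (τ : Fin (N + 1) → ℝ)
    (hne : ∀ j, (∑ l, τ j ^ d l • S l).det ≠ 0)
    (halt : ∀ j : Fin N, (∑ l, τ j.castSucc ^ d l • S l).det * (∑ l, τ j.succ ^ d l • S l).det < 0) :
    (∀ l, (c • S l).IsSymm) ∧ (∀ j, (∑ l, τ j ^ d l • (c • S l)).det ≠ 0) ∧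
      ∀ j : Fin N, (∑ l, τ j.castSucc ^ d l • (c • S l)).det * (∑ l, τ j.succ ^ d l • (c • S l)).det < 0 := by
  have hdet : ∀ y : ℝ, (∑ l, y ^ d l • (c • S l)).det = c ^ m * (∑ l, y ^ d l • S l).det := by
    intro y
    have h : ∑ l, y ^ d l • (c • S l) = c • ∑ l, y ^ d l • S l := by
      rw [Finset.smul_sum]
      exact Finset.sum_congr rfl fun l _ => smul_comm _ _ _
    rw [h, det_smul, Fintype.card_fin]
  have hcm : 0 < c ^ m * c ^ m := mul_self_pos.mpr (pow_ne_zero _ hc)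
  refine ⟨fun l => (hS l).smul c, fun j => ?_, fun j => ?_⟩
  · rw [hdet]
    exact mul_ne_zero (pow_ne_zero _ hc) (hne j)
  · rw [hdet, hdet]
    have h := halt j
    have hrw : c ^ m * (∑ l, τ j.castSucc ^ d l • S l).det * (c ^ m * (∑ l, τ j.succ ^ d l • S l).det)
        = (c ^ m * c ^ m) * ((∑ l, τ j.castSucc ^ d l • S l).det * (∑ l, τ j.succ ^ d l • S l).det) := by ring
    rw [hrw]
    exact mul_neg_of_pos_of_neg hcm h

/-! ### Sylvester matching -/

/-- **Sylvester matching.**  If `Cᵀ A C = diagonal p` and `C'ᵀ B C' = diagonal q` with `C, C'` invertible, and a permutation `π`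
matches the signs (`p i · q (π i) > 0` for all `i`), then `B` is congruent to `A`: `Eᵀ B E = A` for an invertible `E`
(`E = (C' with columns permuted by π) · diagonal √(p i / q (π i)) · C⁻¹`). [folklore] -/
theorem exists_congr_of_diagonal {m : ℕ} {A B : Matrix (Fin m) (Fin m) ℝ} {p q : Fin m → ℝ}
    (hA : ∃ C : Matrix (Fin m) (Fin m) ℝ, C.det ≠ 0 ∧ Cᵀ * A * C = diagonal p)
    (hB : ∃ C : Matrix (Fin m) (Fin m) ℝ, C.det ≠ 0 ∧ Cᵀ * B * C = diagonal q)
    (π : Equiv.Perm (Fin m)) (hpq : ∀ i, 0 < p i * q (π i)) :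
    ∃ E : Matrix (Fin m) (Fin m) ℝ, E.det ≠ 0 ∧ Eᵀ * B * E = A := by
  obtain ⟨C, hC, hCA⟩ := hA
  obtain ⟨C', hC', hC'B⟩ := hB
  -- the diagonal rescaling
  have hqne : ∀ i, q (π i) ≠ 0 := fun i h => by
    have := hpq i; rw [h, mul_zero] at this; exact lt_irrefl 0 this
  have hratio : ∀ i, 0 < p i / q (π i) := fun i => div_pos_iff.mpr (mul_pos_iff.mp (hpq i))
  set δ : Fin m → ℝ := fun i => Real.sqrt (p i / q (π i)) with hδ
  have hδsq : ∀ i, δ i * q (π i) * δ i = p i := fun i => by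
    have h1 : δ i * δ i = p i / q (π i) := Real.mul_self_sqrt (hratio i).le
    calc δ i * q (π i) * δ i = (δ i * δ i) * q (π i) := by ring
      _ = p i := by rw [h1, div_mul_cancel₀ _ (hqne i)]
  have hδne : ∀ i, δ i ≠ 0 := fun i => (Real.sqrt_pos.mpr (hratio i)).ne'
  -- the column-permuted diagonaliser of `B`
  set C'' : Matrix (Fin m) (Fin m) ℝ := C'.submatrix id π with hC''
  have hC''B : C''ᵀ * B * C'' = diagonal (q ∘ π) := by
    have h1 : C''ᵀ * B * C'' = (C'ᵀ * B * C').submatrix π π := by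
      ext i j
      simp only [hC'', Matrix.mul_apply, Matrix.transpose_apply, Matrix.submatrix_apply, id_eq]
    rw [h1, hC'B, submatrix_diagonal_equiv]
  have hC''det : C''.det ≠ 0 := by
    rw [hC'', det_permute']
    exact mul_ne_zero (Int.cast_ne_zero.mpr (Units.ne_zero _)) hC'
  -- the inverse of `C`
  have hCunit : IsUnit C.det := isUnit_iff_ne_zero.mpr hC
  have hCinv : C * C⁻¹ = 1 := mul_nonsing_inv C hCunit
  have hCinv' : C⁻¹ * C = 1 := nonsing_inv_mul C hCunit
  have hA' : A = (C⁻¹)ᵀ * diagonal p * C⁻¹ := by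
    rw [← hCA]
    calc A = (C * C⁻¹)ᵀ * A * (C * C⁻¹) := by rw [hCinv, transpose_one, Matrix.one_mul, Matrix.mul_one]
      _ = (C⁻¹)ᵀ * (Cᵀ * A * C) * C⁻¹ := by rw [transpose_mul]; simp only [Matrix.mul_assoc]
  have hCinvdet : (C⁻¹).det ≠ 0 := by
    have h : (C⁻¹).det * C.det = 1 := by rw [← det_mul, hCinv', det_one]
    exact left_ne_zero_of_mul_eq_one h
  -- the matching congruence
  refine ⟨C'' * diagonal δ * C⁻¹, ?_, ?_⟩
  · rw [det_mul, det_mul, det_diagonal]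
    exact mul_ne_zero (mul_ne_zero hC''det (Finset.prod_ne_zero_iff.mpr fun i _ => hδne i)) hCinvdet
  · have hmid : diagonal δ * (C''ᵀ * B * C'') * diagonal δ = diagonal p := by
      rw [hC''B, diagonal_mul_diagonal, diagonal_mul_diagonal]
      congr 1
      funext i
      exact hδsq i
    calc (C'' * diagonal δ * C⁻¹)ᵀ * B * (C'' * diagonal δ * C⁻¹)
        = (C⁻¹)ᵀ * (diagonal δ * (C''ᵀ * B * C'') * diagonal δ) * C⁻¹ := by
          rw [transpose_mul, transpose_mul, diagonal_transpose]
          simp only [Matrix.mul_assoc]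
      _ = A := by rw [hmid, ← hA']

/-- Congruence data survive a positive rescaling and a further congruence: if `Cᵀ X C = diagonal r` then
`s • Eᵀ X E` (`s > 0`, `E` invertible) is again congruent to `diagonal r`. [folklore] -/
theorem exists_congr_diagonal_smul_conj {m : ℕ} {X E : Matrix (Fin m) (Fin m) ℝ} {r : Fin m → ℝ}
    (hX : ∃ C : Matrix (Fin m) (Fin m) ℝ, C.det ≠ 0 ∧ Cᵀ * X * C = diagonal r) (hE : E.det ≠ 0) {s : ℝ} (hs : 0 < s) :
    ∃ C : Matrix (Fin m) (Fin m) ℝ, C.det ≠ 0 ∧ Cᵀ * (s • (Eᵀ * X * E)) * C = diagonal r := by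
  obtain ⟨C, hC, hCX⟩ := hX
  have hEunit : IsUnit E.det := isUnit_iff_ne_zero.mpr hE
  have hEinv : E * E⁻¹ = 1 := mul_nonsing_inv E hEunit
  have hEinv' : E⁻¹ * E = 1 := nonsing_inv_mul E hEunit
  have hEinvdet : (E⁻¹).det ≠ 0 := by
    have h : (E⁻¹).det * E.det = 1 := by rw [← det_mul, hEinv', det_one]
    exact left_ne_zero_of_mul_eq_one h
  set a : ℝ := (Real.sqrt s)⁻¹ with ha
  have hapos : 0 < a := inv_pos.mpr (Real.sqrt_pos.mpr hs)
  have has : a * a * s = 1 := by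
    rw [ha, ← mul_inv, Real.mul_self_sqrt hs.le, inv_mul_cancel₀ hs.ne']
  refine ⟨a • (E⁻¹ * C), ?_, ?_⟩
  · rw [det_smul, det_mul, Fintype.card_fin]
    exact mul_ne_zero (pow_ne_zero _ hapos.ne') (mul_ne_zero hEinvdet hC)
  · have key : (E⁻¹ * C)ᵀ * (Eᵀ * X * E) * (E⁻¹ * C) = diagonal r := by
      have h2 : (E⁻¹ * C)ᵀ * (Eᵀ * X * E) * (E⁻¹ * C) = Cᵀ * ((E * E⁻¹)ᵀ * X * (E * E⁻¹)) * C := by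
        rw [transpose_mul, transpose_mul]; simp only [Matrix.mul_assoc]
      rw [h2, hEinv, transpose_one, Matrix.one_mul, Matrix.mul_one, hCX]
    rw [transpose_smul]
    simp only [Matrix.smul_mul, Matrix.mul_smul, smul_smul]
    rw [key]
    convert one_smul ℝ (diagonal r) using 2
    linear_combination has

/-! ### The junction law for matching junction inertia -/

/-- **THE JUNCTION LAW FOR MATCHING JUNCTION INERTIA.**  Two strictly supported alternation certificates at size `m` — `P` (`K₁+1` letters,
`N₁` alternations) and `Q` (`K₂+1` letters, `N₂` alternations, `K₂ ≥ 1`) — whose junction letters have MATCHING SIGNED DIAGONAL FORMS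
(`Cᵀ S_last C = diagonal p`, `C'ᵀ T_0 C' = diagonal q`, invertible `C, C'`, and `p i · q (π i) > 0` for a permutation `π`; for
nonsingular letters this is Sylvester's «same inertia») chain to ONE certificate with `K₁ + 1 + K₂` letters on a strictly increasing support
and `N₁ + N₂` alternations.  The first block is `P` verbatim; the second is a congruent, rescaled image of `Q`, and the Sylvester form of the
new TOP letter is that of `Q`'s top letter (`diagonal r`), so further blocks can be appended.  In census words:
**`ζ_sym(m, K₁+K₂+1) ≥ ζ_alt(P) + ζ_alt(Q)` for matching junction inertia.** [folklore] -/
theorem exists_alternating_junction_inertia {m K₁ K₂ N₁ N₂ : ℕ} (hK₂ : 0 < K₂)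
    (d : Fin (K₁ + 1) → ℕ) (S : Fin (K₁ + 1) → Matrix (Fin m) (Fin m) ℝ) (hd : StrictMono d)
    (hS : ∀ l, (S l).IsSymm) (τ : Fin (N₁ + 1) → ℝ) (hτ : StrictMono τ) (hτpos : ∀ j, 0 < τ j)
    (hne : ∀ j, (∑ l, τ j ^ d l • S l).det ≠ 0)
    (halt : ∀ j : Fin N₁, (∑ l, τ j.castSucc ^ d l • S l).det * (∑ l, τ j.succ ^ d l • S l).det < 0)
    (e : Fin (K₂ + 1) → ℕ) (T : Fin (K₂ + 1) → Matrix (Fin m) (Fin m) ℝ) (he : StrictMono e)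
    (hT : ∀ l, (T l).IsSymm) (σ : Fin (N₂ + 1) → ℝ) (hσ : StrictMono σ) (hσpos : ∀ j, 0 < σ j)
    (hne' : ∀ j, (∑ l, σ j ^ e l • T l).det ≠ 0)
    (halt' : ∀ j : Fin N₂, (∑ l, σ j.castSucc ^ e l • T l).det * (∑ l, σ j.succ ^ e l • T l).det < 0)
    {p q r : Fin m → ℝ}
    (hp : ∃ C : Matrix (Fin m) (Fin m) ℝ, C.det ≠ 0 ∧ Cᵀ * S (Fin.last K₁) * C = diagonal p)
    (hq : ∃ C : Matrix (Fin m) (Fin m) ℝ, C.det ≠ 0 ∧ Cᵀ * T 0 * C = diagonal q)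
    (hr : ∃ C : Matrix (Fin m) (Fin m) ℝ, C.det ≠ 0 ∧ Cᵀ * T (Fin.last K₂) * C = diagonal r)
    (π : Equiv.Perm (Fin m)) (hpq : ∀ i, 0 < p i * q (π i)) :
    ∃ (d' : Fin (K₁ + 1 + K₂) → ℕ) (S' : Fin (K₁ + 1 + K₂) → Matrix (Fin m) (Fin m) ℝ)
      (τ' : Fin (N₁ + N₂ + 1) → ℝ),
      StrictMono d' ∧ (∀ i : Fin (K₁ + 1), d' (Fin.castAdd K₂ i) = d i ∧ S' (Fin.castAdd K₂ i) = S i) ∧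
      (∃ C : Matrix (Fin m) (Fin m) ℝ, C.det ≠ 0 ∧
        Cᵀ * S' (Fin.natAdd (K₁ + 1) ⟨K₂ - 1, Nat.sub_lt hK₂ one_pos⟩) * C = diagonal r) ∧
      (∀ l, (S' l).IsSymm) ∧ StrictMono τ' ∧ (∀ j, 0 < τ' j) ∧
      (∀ j, (∑ l, τ' j ^ d' l • S' l).det ≠ 0) ∧
      ∀ j : Fin (N₁ + N₂), (∑ l, τ' j.castSucc ^ d' l • S' l).det * (∑ l, τ' j.succ ^ d' l • S' l).det < 0 := by
  -- Sylvester matching: `Eᵀ T_0 E = S_last`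
  obtain ⟨E, hE, hET⟩ := exists_congr_of_diagonal hp hq π hpq
  -- move the second certificate by `E`
  obtain ⟨hT₁, hne₁, halt₁⟩ := alternating_congr e T hT E hE σ hne' halt'
  obtain ⟨d', S', τ', hd', hold, ⟨Λ, hΛ, hnew⟩, hS', hτ', hpos', hne'', halt''⟩ :=
    exists_alternating_junction d S hd hS τ hτ hτpos hne halt e (fun l => Eᵀ * T l * E) he hT₁ σ hσ hσpos
      hne₁ halt₁ hET
  refine ⟨d', S', τ', hd', hold, ?_, hS', hτ', hpos', hne'', halt''⟩
  -- the new top letter is `(Λ^k)⁻¹ • Eᵀ T_last E`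
  have hlast : (⟨K₂ - 1, Nat.sub_lt hK₂ one_pos⟩ : Fin K₂).succ = Fin.last K₂ := Fin.ext (by simp; omega)
  rw [(hnew ⟨K₂ - 1, Nat.sub_lt hK₂ one_pos⟩).2, hlast]
  exact exists_congr_diagonal_smul_conj hr hE (inv_pos.mpr (pow_pos hΛ _))

/-- Transport of a strictly supported certificate WITH THE SYLVESTER FORM OF ITS TOP LETTER along equalities of the letter count and of
the alternation count (bookkeeping for appending blocks). [folklore] -/
theorem certificateT_transport {m n n' N N' : ℕ} {r : Fin m → ℝ} (hn : n = n') (hN : N = N')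
    (h : ∃ (d : Fin n → ℕ) (S : Fin n → Matrix (Fin m) (Fin m) ℝ) (τ : Fin (N + 1) → ℝ),
      StrictMono d ∧ (∀ h1 : 0 < n, ∃ C : Matrix (Fin m) (Fin m) ℝ, C.det ≠ 0 ∧
        Cᵀ * S ⟨n - 1, Nat.sub_lt h1 one_pos⟩ * C = diagonal r) ∧
      (∀ l, (S l).IsSymm) ∧ StrictMono τ ∧ (∀ j, 0 < τ j) ∧ (∀ j, (∑ l, τ j ^ d l • S l).det ≠ 0) ∧
      ∀ j : Fin N, (∑ l, τ j.castSucc ^ d l • S l).det * (∑ l, τ j.succ ^ d l • S l).det < 0) :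
    ∃ (d : Fin n' → ℕ) (S : Fin n' → Matrix (Fin m) (Fin m) ℝ) (τ : Fin (N' + 1) → ℝ),
      StrictMono d ∧ (∀ h1 : 0 < n', ∃ C : Matrix (Fin m) (Fin m) ℝ, C.det ≠ 0 ∧
        Cᵀ * S ⟨n' - 1, Nat.sub_lt h1 one_pos⟩ * C = diagonal r) ∧
      (∀ l, (S l).IsSymm) ∧ StrictMono τ ∧ (∀ j, 0 < τ j) ∧ (∀ j, (∑ l, τ j ^ d l • S l).det ≠ 0) ∧
      ∀ j : Fin N', (∑ l, τ j.castSucc ^ d l • S l).det * (∑ l, τ j.succ ^ d l • S l).det < 0 := by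
  subst hn hN
  exact h

/-- **Appending a block (for mixed chains).**  A strictly supported certificate with `K₁+1` letters and `N₁` alternations whose TOP letter
has Sylvester form `diagonal p`, followed by an explicit strictly supported certificate `Q` (`K₂+1` letters, `K₂ ≥ 1`, `N₂` alternations) whose
bottom / top letters have Sylvester forms `diagonal q` / `diagonal r` with `p i · q (π i) > 0`, gives a strictly supported certificate with
`K₁ + K₂ + 1` letters, `N₁ + N₂` alternations and top Sylvester form `diagonal r`. [folklore] -/
theorem exists_alternating_appendT {m K₁ K₂ N₁ N₂ : ℕ} (hK₂ : 0 < K₂) {p q r : Fin m → ℝ}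
    (hP : ∃ (d : Fin (K₁ + 1) → ℕ) (S : Fin (K₁ + 1) → Matrix (Fin m) (Fin m) ℝ) (τ : Fin (N₁ + 1) → ℝ),
      StrictMono d ∧ (∀ h1 : 0 < K₁ + 1, ∃ C : Matrix (Fin m) (Fin m) ℝ, C.det ≠ 0 ∧
        Cᵀ * S ⟨K₁ + 1 - 1, Nat.sub_lt h1 one_pos⟩ * C = diagonal p) ∧
      (∀ l, (S l).IsSymm) ∧ StrictMono τ ∧ (∀ j, 0 < τ j) ∧ (∀ j, (∑ l, τ j ^ d l • S l).det ≠ 0) ∧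
      ∀ j : Fin N₁, (∑ l, τ j.castSucc ^ d l • S l).det * (∑ l, τ j.succ ^ d l • S l).det < 0)
    (e : Fin (K₂ + 1) → ℕ) (T : Fin (K₂ + 1) → Matrix (Fin m) (Fin m) ℝ) (he : StrictMono e)
    (hT : ∀ l, (T l).IsSymm) (σ : Fin (N₂ + 1) → ℝ) (hσ : StrictMono σ) (hσpos : ∀ j, 0 < σ j)
    (hne' : ∀ j, (∑ l, σ j ^ e l • T l).det ≠ 0)
    (halt' : ∀ j : Fin N₂, (∑ l, σ j.castSucc ^ e l • T l).det * (∑ l, σ j.succ ^ e l • T l).det < 0)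
    (hq : ∃ C : Matrix (Fin m) (Fin m) ℝ, C.det ≠ 0 ∧ Cᵀ * T 0 * C = diagonal q)
    (hr : ∃ C : Matrix (Fin m) (Fin m) ℝ, C.det ≠ 0 ∧ Cᵀ * T (Fin.last K₂) * C = diagonal r)
    (π : Equiv.Perm (Fin m)) (hpq : ∀ i, 0 < p i * q (π i)) :
    ∃ (d : Fin (K₁ + K₂ + 1) → ℕ) (S : Fin (K₁ + K₂ + 1) → Matrix (Fin m) (Fin m) ℝ) (τ : Fin (N₁ + N₂ + 1) → ℝ),
      StrictMono d ∧ (∀ h1 : 0 < K₁ + K₂ + 1, ∃ C : Matrix (Fin m) (Fin m) ℝ, C.det ≠ 0 ∧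
        Cᵀ * S ⟨K₁ + K₂ + 1 - 1, Nat.sub_lt h1 one_pos⟩ * C = diagonal r) ∧
      (∀ l, (S l).IsSymm) ∧ StrictMono τ ∧ (∀ j, 0 < τ j) ∧ (∀ j, (∑ l, τ j ^ d l • S l).det ≠ 0) ∧
      ∀ j : Fin (N₁ + N₂), (∑ l, τ j.castSucc ^ d l • S l).det * (∑ l, τ j.succ ^ d l • S l).det < 0 := by
  obtain ⟨d, S, τ, hd, hp, hS, hτ, hpos, hne, halt⟩ := hP
  have hp' : ∃ C : Matrix (Fin m) (Fin m) ℝ, C.det ≠ 0 ∧ Cᵀ * S (Fin.last K₁) * C = diagonal p := by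
    have h := hp (Nat.succ_pos K₁)
    have hidx : (⟨K₁ + 1 - 1, Nat.sub_lt (Nat.succ_pos K₁) one_pos⟩ : Fin (K₁ + 1)) = Fin.last K₁ := Fin.ext rfl
    rw [hidx] at h
    exact h
  obtain ⟨d', S', τ', hd', -, htop, hS', hτ', hpos', hne'', halt''⟩ :=
    exists_alternating_junction_inertia hK₂ d S hd hS τ hτ hpos hne halt e T he hT σ hσ hσpos hne' halt' hp' hq hr π hpq
  refine certificateT_transport (n := K₁ + 1 + K₂) (by omega) rfl ⟨d', S', τ', hd', fun h1 => ?_, hS', hτ', hpos', hne'', halt''⟩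
  have hidx : (⟨K₁ + 1 + K₂ - 1, Nat.sub_lt h1 one_pos⟩ : Fin (K₁ + 1 + K₂))
      = Fin.natAdd (K₁ + 1) ⟨K₂ - 1, Nat.sub_lt hK₂ one_pos⟩ := Fin.ext (by simp; omega)
  rw [hidx]
  exact htop

/-- **Starting block (for mixed chains).**  An explicit strictly supported certificate with top Sylvester form `diagonal r`, packaged. [folklore] -/
theorem exists_alternating_startT {m K N : ℕ} {r : Fin m → ℝ}
    (d : Fin (K + 1) → ℕ) (S : Fin (K + 1) → Matrix (Fin m) (Fin m) ℝ) (hd : StrictMono d)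
    (hS : ∀ l, (S l).IsSymm) (τ : Fin (N + 1) → ℝ) (hτ : StrictMono τ) (hpos : ∀ j, 0 < τ j)
    (hne : ∀ j, (∑ l, τ j ^ d l • S l).det ≠ 0)
    (halt : ∀ j : Fin N, (∑ l, τ j.castSucc ^ d l • S l).det * (∑ l, τ j.succ ^ d l • S l).det < 0)
    (hr : ∃ C : Matrix (Fin m) (Fin m) ℝ, C.det ≠ 0 ∧ Cᵀ * S (Fin.last K) * C = diagonal r) :
    ∃ (d : Fin (K + 1) → ℕ) (S : Fin (K + 1) → Matrix (Fin m) (Fin m) ℝ) (τ : Fin (N + 1) → ℝ),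
      StrictMono d ∧ (∀ h1 : 0 < K + 1, ∃ C : Matrix (Fin m) (Fin m) ℝ, C.det ≠ 0 ∧
        Cᵀ * S ⟨K + 1 - 1, Nat.sub_lt h1 one_pos⟩ * C = diagonal r) ∧
      (∀ l, (S l).IsSymm) ∧ StrictMono τ ∧ (∀ j, 0 < τ j) ∧ (∀ j, (∑ l, τ j ^ d l • S l).det ≠ 0) ∧
      ∀ j : Fin N, (∑ l, τ j.castSucc ^ d l • S l).det * (∑ l, τ j.succ ^ d l • S l).det < 0 := by
  refine ⟨d, S, τ, hd, fun h1 => ?_, hS, hτ, hpos, hne, halt⟩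
  have hidx : (⟨K + 1 - 1, Nat.sub_lt h1 one_pos⟩ : Fin (K + 1)) = Fin.last K := Fin.ext rfl
  rw [hidx]
  exact hr

/-- **Row form**: a packaged certificate with `K` letters and `N ≥ 1` alternations refutes `PosRootLawAt m K (N − 1)`. [folklore] -/
theorem not_posRootLawAt_of_certificateT {m K N : ℕ} {r : Fin m → ℝ} (hN : 1 ≤ N)
    (h : ∃ (d : Fin K → ℕ) (S : Fin K → Matrix (Fin m) (Fin m) ℝ) (τ : Fin (N + 1) → ℝ),
      StrictMono d ∧ (∀ h1 : 0 < K, ∃ C : Matrix (Fin m) (Fin m) ℝ, C.det ≠ 0 ∧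
        Cᵀ * S ⟨K - 1, Nat.sub_lt h1 one_pos⟩ * C = diagonal r) ∧
      (∀ l, (S l).IsSymm) ∧ StrictMono τ ∧ (∀ j, 0 < τ j) ∧ (∀ j, (∑ l, τ j ^ d l • S l).det ≠ 0) ∧
      ∀ j : Fin N, (∑ l, τ j.castSucc ^ d l • S l).det * (∑ l, τ j.succ ^ d l • S l).det < 0) :
    ¬ PosRootLawAt m K (N - 1) := by
  obtain ⟨d, S, τ, -, -, hS, hτ, hpos, -, halt⟩ := h
  exact not_posRootLawAt_of_alternating hN d S hS τ hτ hpos halt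

/-- **Sylvester form from a rational diagonalisation**: `M A Mᵀ = diagonal p` with `det M ≠ 0` gives `Cᵀ A C = diagonal p` with
`C = Mᵀ` (the shape the per-block data lemmas check by `norm_num`). [folklore] -/
theorem exists_congr_diagonal_of_mul {m : ℕ} {A M : Matrix (Fin m) (Fin m) ℝ} {p : Fin m → ℝ}
    (hM : M.det ≠ 0) (h : M * A * Mᵀ = diagonal p) :
    ∃ C : Matrix (Fin m) (Fin m) ℝ, C.det ≠ 0 ∧ Cᵀ * A * C = diagonal p :=
  ⟨Mᵀ, by rwa [det_transpose], by rwa [transpose_transpose]⟩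

/-- Sylvester forms scale: `Cᵀ A C = diagonal p` gives `Cᵀ (c • A) C = diagonal (c • p)`. [folklore] -/
theorem exists_congr_diagonal_smul {m : ℕ} {A : Matrix (Fin m) (Fin m) ℝ} {p : Fin m → ℝ}
    (h : ∃ C : Matrix (Fin m) (Fin m) ℝ, C.det ≠ 0 ∧ Cᵀ * A * C = diagonal p) (c : ℝ) :
    ∃ C : Matrix (Fin m) (Fin m) ℝ, C.det ≠ 0 ∧ Cᵀ * (c • A) * C = diagonal (c • p) := by
  obtain ⟨C, hC, hCA⟩ := h
  refine ⟨C, hC, ?_⟩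
  rw [Matrix.mul_smul, Matrix.smul_mul, hCA, ← diagonal_smul]

end Summit.ValiantsHypothesis.ValiantsHypothesis.Theorems.LacunarySymmetroidMatrixDescartes.Census.Chain
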